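import Summits.BirchSwinnertonDyer.BirchSwinnertonDyer.Theorems.KolyvaginDepthDoorKolyvaginDepthSupplyLeafReciprocityOfPoitouTate
import Summits.BirchSwinnertonDyer.Rank1Residual.P2.CMKolyvaginMachineBindersAtTwo
import Literature.NumberTheory.GaloisCohomology.PoitouTateNumberField
import Literature.NumberTheory.EllipticCurves.ModularityVersionApProofs
import Literature.NumberTheory.EllipticCurves.SelmerCorankControlRatProofs
import HarnessLib

/-!
# Route `CMKolyvaginAtInertTwo`, crux `CMKolyvaginExactAtInertTwo` (stmt-BirchSwinnertonDyer-24277):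
# item (0c) — THE RECIPROCITY FAMILY OF THE KERNEL KOLYVAGIN MACHINE IS A THEOREM AT EVERY PRIME,
# `p = 2` and CM included: `Nonempty (KolyvaginMachine.ReciprocityFamily N W K p S)`

Seat `bsd-line-cmk2-p1` g9 (cell `bsd-print-cf2`); helper (`--supports stmt-BirchSwinnertonDyer-24277`).
THEOREMS ONLY (no definition, no named fact, no instance, no `sorry`); no item is closed; BSD is not
proved by this.

WHAT. ty2's `Rank1Residual/P2/CMKolyvaginMachineBindersAtTwo.lean` (p601266) types the second input of the
kernel Kolyvagin machine — the binder `hRT` of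
`KolyvaginDescent.pow_smul_sha_primary_eq_zero_at_of_pointsM_of_reciprocityFinset`, McCallum's Prop. 2.2 in
PAIRING FORM at a Kolyvagin prime `λ` of `(p, M)`: an alternating non-degenerate pairing `e` on `E[p^M]`
with `e([s, F], [c′, σ]) = 0` for `s` Selmer and vanishing on a finite set `T` of places and `c′` Selmer
off `T ∪ {λ}` and at infinity — as DATA (`ReciprocityPairing` / `ReciprocityFamily N W K p S`, prime `p`
free, "PRINTED for `p` odd without CM … at `p = 2` / CM a HYPOTHESIS of the line's items"), and the
`p = 2` descent files of this line TAKE `(R : ReciprocityFamily (W.conductorNorm ℤ) W K 2 (CMInert W))`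
as a hypothesis (g6 `conjAct_eq_self_of_cmInert_families_two`, g7 `…_of_cmInert_families_two_pow`, g8's
`M₀ = 0` case of the crux `selmer_two_eq_zero_or_eq_kummer_of_cmInert_prime_discr_of_plumbing`). The
pen's booking memo (planner g13, `BOOKING-TARGET-H2-levelzero.md` v2 §2, item (0c)₂¹) asks for the datum
to become a THEOREM on H₂.

THIS FILE makes it a theorem — for EVERY prime `p` (so `p = 2`), EVERY elliptic `W/ℚ` (CM allowed, no
habitat hypothesis), EVERY number field `K : Type`, every support `S`, at every level `p^M` — by composing
two theorems of OTHER cells that the line had not imported: (i) the law itself, x11b3's derivation from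
Poitou–Tate re-bound WITHOUT its idle rank-one binders (no `p ≠ 2`, no `¬ HasCM`, no Heegner point; good
reduction at `λ` as the hypothesis) by the `KolyvaginDepthDoor` seat —
`KolyvaginDepthDoor.kolyvaginReciprocityFinset_of_poitouTate_of_hasGoodReductionAt` (Weil pairing on
`E[p^M]`, isotropy of the Kummer images off `T ∪ {λ}`, the Poitou–Tate sum over `{λ} ∪ T`, injectivity of
`inv_λ`, and the local half `TameCup.weilPairing_apply_eq_one_of_cupProduct_eq_zero` = Gross (7.6)); (ii)
the Poitou–Tate input PROVED for every number field `K : Type` by cell `bsd-cn100`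
(`poitouTate_sum_localTatePairing_eq_zero_holds`). §2 supplies good reduction of `W/K` at `λ` — from a
Heegner point of level `N` (the tree's `IsKolyvaginPrime.not_mem_badPlaces`), or with NO Heegner point for
`N = N_E = W.conductorNorm ℤ` from `ℓ ∤ N_E` (`dvd_conductorNorm_iff`,
`hasGoodReductionAt_baseChange_of_hasGoodReductionAt_rat`); §3 packages the law as
`Nonempty (ReciprocityPairing …)` / `Nonempty (ReciprocityFamily …)` given `hPT`; §4 discharges `hPT` for
`K : Type` (`nonempty_reciprocityFamily_conductorNorm`, `…_of_isHeegnerPoint`, and the Prop binder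
`hRT_conductorNorm` in the machine's shape); §5 is the line's reading, `p = 2`, `S := CMInert W`:
**`nonempty_reciprocityFamily_two_cmInert : Nonempty (ReciprocityFamily (W.conductorNorm ℤ) W K 2 (CMInert W))`**
— so `obtain ⟨R⟩ := nonempty_reciprocityFamily_two_cmInert W K` discharges the binder `R` of every `p = 2`
descent file of the line. What remains DATA at `p = 2` is the point system `(D : PointSystemFamily …)`
(item (0b)). Why nothing here needs `p` odd or no CM: Tate local duality, the reciprocity law of the Brauer
group and the Weil pairing hold at every `p`; McCallum's Prop. 2.2 is stated for all `p` (only his §5 takes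
`p` odd); Gross (7.6) is the tame symbol at `λ ∤ p`. Beyond print: NO. BSD is not proved by this.

References: [McCallumLMS1991] §2 Prop. 2.2, §5 Lemma 5.3 (PDF pp. 277–286); [GrossLMS1991] §3 (3.1)–(3.2),
§7 (7.1)–(7.6); [MilneADT2006] I Cor. 2.3, Thm. 4.10 (b); [CasselsFrohlichANT1967] VII §11;
[SilvermanAEC2009] VII.5.1; [DiamondShurman2005] §8.3 (PDF p. 353).
-/

-- single-conjunct summit: `Summit.BirchSwinnertonDyer.BirchSwinnertonDyer.…` repeats the name by design
set_option linter.dupNamespace false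
set_option autoImplicit false

noncomputable section

open scoped Classical

universe u

namespace Summit.BirchSwinnertonDyer.BirchSwinnertonDyer.Theorems.KolyvaginReciprocityTwo

open WeierstrassCurve NumberField IsDedekindDomain Field
open Literature.NumberTheory.EllipticCurves
open Literature.NumberTheory.GaloisRepresentations
open Literature.NumberTheory.GaloisCohomology
open Summit.BirchSwinnertonDyer.Rank1Residual.P2.KolyvaginMachine
open Rat.HeightOneSpectrum (primesEquiv)

variable (N : ℕ) (W : WeierstrassCurve ℚ) (K : Type u) [Field K] [NumberField K]

/-! ## §2 Good reduction of `W/K` at the place of a Kolyvagin prime -/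

variable {N W K} in
/-- Good reduction of `W/K` at `λ = (ℓ)` for a Kolyvagin prime `ℓ` of level `N`, from a Heegner point of
level `N` over `K` (its parametrisation puts the bad primes into `N`, and `ℓ ∤ N`): the tree's
`IsKolyvaginPrime.not_mem_badPlaces` unfolded. [cite: GrossLMS1991, §3 (3.1) with §7] -/
theorem hasGoodReductionAt_place_of_isHeegnerPoint [NeZero N] [W.IsElliptic]
    {P : (W.baseChange K).toAffine.Point} (hP : IsHeegnerPoint N W K P)
    {p ℓ : ℕ} (hℓ : IsKolyvaginPrime N W K p ℓ) :
    (W.baseChange K).HasGoodReductionAt hℓ.place := by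
  have h := hℓ.not_mem_badPlaces hP
  rwa [mem_badPlaces_iff, not_not] at h

variable {W K} in
/-- Good reduction of `W/K` at `λ = (ℓ)` for a Kolyvagin prime `ℓ` of level `N_E = W.conductorNorm ℤ`:
`ℓ ∤ N_E` is good reduction of `W/ℚ` at `ℓ` (`dvd_conductorNorm_iff`), which base-changes to `λ ∣ ℓ`
(`hasGoodReductionAt_baseChange_of_hasGoodReductionAt_rat`). No Heegner point needed.
[cite: GrossLMS1991, §3 (3.1)] [cite: DiamondShurman2005, §8.3 (PDF p. 353)] -/
theorem hasGoodReductionAt_place_conductorNorm [W.IsElliptic]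
    {p ℓ : ℕ} (hℓ : IsKolyvaginPrime (W.conductorNorm ℤ) W K p ℓ) :
    (W.baseChange K).HasGoodReductionAt hℓ.place := by
  -- the place `v` of `ℚ` under `λ`
  let v : HeightOneSpectrum (𝓞 ℚ) := hℓ.place.under (𝓞 ℚ)
  have hℓv : (ℓ : 𝓞 ℚ) ∈ v.asIdeal := hℓ.natCast_mem_under
  have hveq : ((primesEquiv v : Nat.Primes) : ℕ) = ℓ := primesEquiv_eq_of_natCast_mem hℓ.prime hℓv
  have hgood : W.HasGoodReductionAt v := by
    by_contra h
    exact hℓ.2.1 (hveq ▸ (W.dvd_conductorNorm_iff v).mpr h)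
  haveI : hℓ.place.asIdeal.LiesOver v.asIdeal := ⟨rfl⟩
  exact hasGoodReductionAt_baseChange_of_hasGoodReductionAt_rat W v hℓ.place hgood

/-! ## §3 The data: `Nonempty (ReciprocityPairing …)`, `Nonempty (ReciprocityFamily …)` -/

variable {N W K} in
/-- **ty2's datum `ReciprocityPairing N W K p M hℓ` is inhabited** at every prime `p`, every `M ≥ 1` and every
Kolyvagin prime `ℓ` of `(N, W, K, p)` with good reduction of `W/K` at `λ`, GIVEN `hPT` (the Weil pairing
and the law of §1 are its fields). [cite: McCallumLMS1991, §2 Prop. 2.2, §5 Lemma 5.3] [cite: GrossLMS1991, §7 (7.6)] -/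
theorem nonempty_reciprocityPairing_of_poitouTate_of_good (hPT : poitouTate_sum_localTatePairing_eq_zero K)
    [W.IsElliptic] {p : ℕ} (hp : p.Prime) {M : ℕ} (hM : 1 ≤ M)
    {ℓ : ℕ} (hℓ : IsKolyvaginPrime N W K p ℓ) (hgood : (W.baseChange K).HasGoodReductionAt hℓ.place) :
    Nonempty (ReciprocityPairing N W K p M hℓ) := by
  obtain ⟨A, str, e, halt, hnondeg, hrecip⟩ :=
    KolyvaginDepthDoor.kolyvaginReciprocityFinset_of_poitouTate_of_hasGoodReductionAt N W K hPT hp hM hℓ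
      hgood
  exact ⟨{ A := A, str := str, e := e, alt := halt, nondeg := hnondeg, recip := hrecip }⟩

variable {N W K} in
/-- **ty2's `ReciprocityFamily N W K p S` is inhabited, GIVEN `hPT`**, at every prime `p` and every support
`S` whose Kolyvagin primes are primes of good reduction of `W/K` (every level `p^M`, `M ≥ 1`; the extra
premise `Frob(ℓ) = Frob(∞)` on `K(E[p^M])` of the family is not even used).
[cite: McCallumLMS1991, §2 Prop. 2.2, §5 Lemma 5.3] [cite: GrossLMS1991, §7 (7.6)] -/
theorem nonempty_reciprocityFamily_of_poitouTate_of_good (hPT : poitouTate_sum_localTatePairing_eq_zero K)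
    [W.IsElliptic] {p : ℕ} (hp : p.Prime) {S : ℕ → Prop}
    (hgood : ∀ ⦃ℓ : ℕ⦄ (hℓ : IsKolyvaginPrime N W K p ℓ), S ℓ →
      (W.baseChange K).HasGoodReductionAt hℓ.place) :
    Nonempty (ReciprocityFamily N W K p S) :=
  ⟨fun _ hM _ hℓ _ hS ↦
    Classical.choice (nonempty_reciprocityPairing_of_poitouTate_of_good hPT hp hM hℓ (hgood hℓ hS))⟩

variable {N W K} in
/-- **The reciprocity family at level `N` from a Heegner point of level `N`, GIVEN `hPT`** (any prime
`p`, any support `S`, CM allowed). [cite: McCallumLMS1991, §2 Prop. 2.2] [cite: GrossLMS1991, §3 (3.1), §7 (7.6)] -/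
theorem nonempty_reciprocityFamily_of_isHeegnerPoint_of_poitouTate [NeZero N]
    (hPT : poitouTate_sum_localTatePairing_eq_zero K) [W.IsElliptic]
    {P : (W.baseChange K).toAffine.Point} (hP : IsHeegnerPoint N W K P)
    {p : ℕ} (hp : p.Prime) (S : ℕ → Prop) :
    Nonempty (ReciprocityFamily N W K p S) :=
  nonempty_reciprocityFamily_of_poitouTate_of_good hPT hp fun _ hℓ _ ↦
    hasGoodReductionAt_place_of_isHeegnerPoint hP hℓ

variable {W K} in
/-- **The reciprocity family at level `N_E = W.conductorNorm ℤ`, GIVEN `hPT`** (any prime `p`, any support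
`S`, any elliptic `W/ℚ`, CM allowed; no Heegner point). [cite: McCallumLMS1991, §2 Prop. 2.2] [cite: GrossLMS1991, §3 (3.1), §7 (7.6)] -/
theorem nonempty_reciprocityFamily_conductorNorm_of_poitouTate
    (hPT : poitouTate_sum_localTatePairing_eq_zero K) [W.IsElliptic] [NeZero (W.conductorNorm ℤ)]
    {p : ℕ} (hp : p.Prime) (S : ℕ → Prop) :
    Nonempty (ReciprocityFamily (W.conductorNorm ℤ) W K p S) :=
  nonempty_reciprocityFamily_of_poitouTate_of_good hPT hp fun _ hℓ _ ↦
    hasGoodReductionAt_place_conductorNorm hℓ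

/-! ## §4 Unconditional for `K : Type`: the Poitou–Tate input is a theorem of the tree -/

/-- **(0c) AS A THEOREM — the reciprocity family at level `N_E` for every elliptic `W/ℚ`, every number
field `K : Type`, every prime `p` and every support `S`** (Poitou–Tate discharged by
`poitouTate_sum_localTatePairing_eq_zero_holds`, cell `bsd-cn100`). [cite: McCallumLMS1991, §2 Prop. 2.2, §5 Lemma 5.3]
[cite: GrossLMS1991, §7 (7.6)] [cite: MilneADT2006, Ch. I Thm. 4.10(b), Cor. 2.3] -/
theorem nonempty_reciprocityFamily_conductorNorm (W : WeierstrassCurve ℚ) [W.IsElliptic]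
    [NeZero (W.conductorNorm ℤ)] (K : Type) [Field K] [NumberField K]
    {p : ℕ} (hp : p.Prime) (S : ℕ → Prop) :
    Nonempty (ReciprocityFamily (W.conductorNorm ℤ) W K p S) :=
  nonempty_reciprocityFamily_conductorNorm_of_poitouTate
    (poitouTate_sum_localTatePairing_eq_zero_holds K) hp S

/-- **The reciprocity family at level `N` from a Heegner point of level `N`, for `K : Type`, unconditionally**
(any prime `p`, any `S`, CM allowed). [cite: McCallumLMS1991, §2 Prop. 2.2] [cite: GrossLMS1991, §3 (3.1), §7 (7.6)] -/
theorem nonempty_reciprocityFamily_of_isHeegnerPoint (N : ℕ) [NeZero N] (W : WeierstrassCurve ℚ)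
    [W.IsElliptic] (K : Type) [Field K] [NumberField K]
    {P : (W.baseChange K).toAffine.Point} (hP : IsHeegnerPoint N W K P)
    {p : ℕ} (hp : p.Prime) (S : ℕ → Prop) :
    Nonempty (ReciprocityFamily N W K p S) :=
  nonempty_reciprocityFamily_of_isHeegnerPoint_of_poitouTate
    (poitouTate_sum_localTatePairing_eq_zero_holds K) hP hp S

/-- The pairing-form law itself (the machine's binder `hRT` with support `S`, verbatim as
`hRT_of_reciprocityFamily` states it) at level `N_E`, for `K : Type`, unconditionally — for consumers that
take the Prop binder rather than ty2's data. [cite: McCallumLMS1991, §2 Prop. 2.2, §5 Lemma 5.3] [cite: GrossLMS1991, §7 (7.6)] -/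
theorem hRT_conductorNorm (W : WeierstrassCurve ℚ) [W.IsElliptic] [NeZero (W.conductorNorm ℤ)]
    (K : Type) [Field K] [NumberField K] {p : ℕ} (hp : p.Prime) (S : ℕ → Prop) :
    ∀ {M : ℕ} (_hM : 1 ≤ M) {ℓ : ℕ} (hℓ : IsKolyvaginPrime (W.conductorNorm ℤ) W K p ℓ),
      FrobEqFrobInfty W K (p ^ M) ℓ → S ℓ →
      ∃ (A : Type) (_ : AddCommGroup A)
        (e : geomTorsion (W.baseChange K) ((p ^ M : ℕ) : ℤ) →+
          geomTorsion (W.baseChange K) ((p ^ M : ℕ) : ℤ) →+ A),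
        (∀ x, e x x = 0) ∧ (∀ x, (∀ y, e x y = 0) → x = 0) ∧
        ∀ (T : Finset (HeightOneSpectrum (𝓞 K))),
        ∀ s ∈ selmerGroup (W.baseChange K) ((p ^ M : ℕ) : ℤ),
          (∀ v ∈ T, s ∈ (W.baseChange K).torsionLocalKer (v.adicCompletion K) ((p ^ M : ℕ) : ℤ)) →
          ∀ c' : galH1Torsion (W.baseChange K) ((p ^ M : ℕ) : ℤ),
          (∀ v : HeightOneSpectrum (𝓞 K), v ∉ T → (ℓ : 𝓞 K) ∉ v.asIdeal →
            c' ∈ selmerLocalKer (W.baseChange K) (v.adicCompletion K) ((p ^ M : ℕ) : ℤ)) →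
          (∀ w : InfinitePlace K,
            c' ∈ selmerLocalKer (W.baseChange K) w.Completion ((p ^ M : ℕ) : ℤ)) →
          ∀ 𝔔 ∈ hℓ.place.primesAbove, ∀ F : Field.absoluteGaloisGroup K,
            IsArithFrobAt (𝓞 K) F 𝔔 →
            F ∈ torsionFixing (W.baseChange K) ((p ^ M : ℕ) : ℤ) →
            ∀ σ ∈ 𝔔.inertia (Field.absoluteGaloisGroup K),
            e (h1Eval (W.baseChange K) ((p ^ M : ℕ) : ℤ) s F)
              (h1Eval (W.baseChange K) ((p ^ M : ℕ) : ℤ) c' σ) = 0 :=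
  hRT_of_reciprocityFamily (Classical.choice (nonempty_reciprocityFamily_conductorNorm W K hp S))

/-! ## §5 The line's reading: `p = 2`, `S := Rank1Residual.CMInert W` -/

/-- **(0c)₂¹ and every level: the `p = 2` reciprocity family supported on the CM-inert Kolyvagin primes is
INHABITED** — for every elliptic `W/ℚ` (CM or not, no habitat hypothesis) and every number field `K : Type`:
the hypothesis `(R : ReciprocityFamily (W.conductorNorm ℤ) W K 2 (CMInert W))` of the line's `p = 2`
descent files (g6 `conjAct_eq_self_of_cmInert_families_two`, g7 `…_of_cmInert_families_two_pow`, g8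
`selmer_two_eq_zero_or_eq_kummer_of_cmInert_prime_discr_of_plumbing`) is discharged by
`obtain ⟨R⟩ := nonempty_reciprocityFamily_two_cmInert W K`. [cite: McCallumLMS1991, §2 Prop. 2.2, §5 Lemma 5.3]
[cite: GrossLMS1991, §7 (7.6)] [cite: MilneADT2006, Ch. I Thm. 4.10(b), Cor. 2.3] -/
theorem nonempty_reciprocityFamily_two_cmInert (W : WeierstrassCurve ℚ) [W.IsElliptic]
    [NeZero (W.conductorNorm ℤ)] (K : Type) [Field K] [NumberField K] :
    Nonempty (ReciprocityFamily (W.conductorNorm ℤ) W K 2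
      (Literature.NumberTheory.EllipticCurves.Rank1Residual.CMInert W)) :=
  nonempty_reciprocityFamily_conductorNorm W K Nat.prime_two _

/-- The same with the machine's full support `⊤` at `p = 2` (restricts to any `S`,
`ReciprocityFamily.restrict`). [cite: McCallumLMS1991, §2 Prop. 2.2] [cite: GrossLMS1991, §7 (7.6)] -/
theorem nonempty_reciprocityFamily_two_top (W : WeierstrassCurve ℚ) [W.IsElliptic]
    [NeZero (W.conductorNorm ℤ)] (K : Type) [Field K] [NumberField K] :
    Nonempty (ReciprocityFamily (W.conductorNorm ℤ) W K 2 fun _ ↦ True) :=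
  nonempty_reciprocityFamily_conductorNorm W K Nat.prime_two _

end Summit.BirchSwinnertonDyer.BirchSwinnertonDyer.Theorems.KolyvaginReciprocityTwo

end
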